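import Literature.Computability.AlgebraicComplexity.ProjectedShiftedPartialsLower
import HarnessLib

/-!
# Projected shifted partials: the pair-count lower bound (Kumar–Saraf 2017, §5.1 and §8.5,
Lemma 8.9 in deterministic form)

Topic `Literature/Computability/AlgebraicComplexity`; a complement to
`ProjectedShiftedPartialsLower.lean` (namespace `KumarSaraf`: `sSet`, `aSet`, Lemma 5.1
`card_biUnion_aSet_le_pspDim`, Lemma 5.3 `card_biUnion_sSet_le_sum_card_aSet`, and the
Cauchy–Schwarz form `sq_sum_card_le` of Lemma 3.8), written for the discharge of the barrier fact
`Literature.Barriers.ValiantsHypothesis.DepthReductionChasmDepthFour`.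

Kumar–Saraf lower-bound the measure `Φ_{ℳ,m}(P)` by `|⋃_{α,β} A_m(α,β)|` and estimate that union
by two truncated inclusion–exclusions, controlled by the pair sums `T₂` (pairs `β, γ` of monomials
of the same derivative) and `T₃` (pairs from arbitrary derivatives), §5.1 and §8.5. This file
packages the whole of that step as ONE deterministic inequality, `sum_card_support_mul_choose_le`:
if every derivative `∂_α P` (`α ∈ ℳ`) has multilinear monomials of support size `b`, and for every
`(α, β)`

* `∑_{β' ∈ supp ∂_α P} C(N - |β ∪ β'|, m) ≤ E · C(N - b, m)`      (the `T₂/T₁` ratio), and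
* `∑_{α'} ∑_{β' ∈ supp ∂_{α'} P} C(N - |β ∪ β'|, m - |β' ∖ β|) ≤ Λ · C(N - b, m)`  (`T₃/T₁`),

then `(∑_α |supp ∂_α P|) · C(N - b, m) ≤ Φ_{ℳ,m}(P) · E² · Λ`. Both inclusion–exclusions are done
with Cauchy–Schwarz (`|⋃ Wᵢ| ≥ (∑|Wᵢ|)² / ∑ᵢⱼ|Wᵢ ∩ Wⱼ|`), which loses `E²Λ` instead of the
printed `O(λ λ')` but needs no largeness assumptions. The one new count is
`card_aSet_inter_le`: `|A_m(α,β) ∩ A_m(α',β')| ≤ C(N - |β ∪ β'|, m - |β'∖β|)` (§8.5, the bound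
used for `T₃`).

## References

* M. Kumar, S. Saraf, *On the power of homogeneous depth 4 arithmetic circuits*, SIAM J. Comput.
  46 (2017) 336–387 (arXiv:1404.1950v3): §5.1, §8.5, Lemma 8.9.
-/

noncomputable section

open MvPolynomial Finset

namespace Literature.Computability.AlgebraicComplexity.KumarSaraf

open GKKS

/-! ### Cauchy–Schwarz over all ordered pairs -/

section CS

variable {ι α : Type*} [DecidableEq α] [DecidableEq ι]

/-- `∑ᵢ ∑ⱼ |Wᵢ ∩ Wⱼ| = ∑ᵢ |Wᵢ| + ∑_{i ≠ j} |Wᵢ ∩ Wⱼ|` (diagonal plus off-diagonal). [folklore] -/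
theorem sum_sum_card_inter_eq (s : Finset ι) (W : ι → Finset α) :
    ∑ i ∈ s, ∑ j ∈ s, (W i ∩ W j).card =
      ∑ i ∈ s, (W i).card + ∑ i ∈ s, ∑ j ∈ s.erase i, (W i ∩ W j).card := by
  rw [← Finset.sum_add_distrib]
  refine Finset.sum_congr rfl fun i hi => ?_
  rw [← Finset.add_sum_erase s _ hi, Finset.inter_self]

/-- **Cauchy–Schwarz for a union of finite sets, all-pairs form**:
`(∑ᵢ |Wᵢ|)² ≤ |⋃ᵢ Wᵢ| · ∑ᵢ ∑ⱼ |Wᵢ ∩ Wⱼ|` (from `sq_sum_card_le`). [cite: KumarSaraf2017, Lemma 3.8] -/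
theorem sq_sum_card_le_card_biUnion_mul_sum_sum (s : Finset ι) (W : ι → Finset α) :
    (∑ i ∈ s, (W i).card) ^ 2 ≤ (s.biUnion W).card * ∑ i ∈ s, ∑ j ∈ s, (W i ∩ W j).card := by
  rw [sum_sum_card_inter_eq]
  exact sq_sum_card_le s W

end CS

/-! ### The count `|A_m(α,β) ∩ A_m(α',β')|` (KS, §8.5) -/

section Inter

variable {K : Type*} [Field K] {σ : Type*} [Fintype σ] [DecidableEq σ]

omit [Fintype σ] in
/-- `x^γ x^β` is multilinear for `γ` disjoint from the multilinear `x^β`. [folklore] -/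
theorem isML_chi_add {γ : Finset σ} {β : σ →₀ ℕ} (hd : Disjoint γ β.support) (hβ : IsML β) :
    IsML (chi γ + β) := by
  intro v
  rw [Finsupp.add_apply, chi_apply]
  split_ifs with hv
  · rw [Finsupp.notMem_support_iff.1 (Finset.disjoint_left.1 hd hv)]
    exact le_rfl
  · rw [zero_add]; exact hβ v

omit [Fintype σ] in
/-- The support of `x^γ x^β` for `γ` disjoint from `supp β`. [folklore] -/
theorem support_chi_add {γ : Finset σ} {β : σ →₀ ℕ} (hd : Disjoint γ β.support) :
    (chi γ + β).support = γ ∪ β.support := by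
  rw [Finsupp.support_add_eq (by rwa [support_chi]), support_chi]

/-- **`|A_m(α,β) ∩ A_m(α',β')| ≤ C(N - |β ∪ β'|, m - |β' ∖ β|)`** for multilinear `β` with
`|supp β| = b` (Kumar–Saraf 2017, §8.5: "`|A_m(α₁,β₁) ∩ A_m(α₂,β₂)|` is upper bounded by the
number of multilinear monomials `γ` of degree `m` such that `γβ₁ = γβ₂`", i.e. by
`C(N-k-Δ(β,γ), m-Δ(β,γ))`): a common element contains `supp β ∪ supp β'` and is determined by its
`(m - |β'∖β|)` variables outside it. [cite: KumarSaraf2017, §8.5] -/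
theorem card_aSet_inter_le (mo : MonomialOrder σ) (g g' : MvPolynomial σ K) (m : ℕ) {b : ℕ}
    {β : σ →₀ ℕ} (β' : σ →₀ ℕ) (hβ : IsML β) (hb : β.support.card = b) :
    (aSet K mo g m β ∩ aSet K mo g' m β').card ≤
      (Fintype.card σ - (β.support ∪ β'.support).card).choose
        (m - (β'.support \ β.support).card) := by
  set D : Finset σ := β.support ∪ β'.support with hD
  have hcardD : D.card = b + (β'.support \ β.support).card := by
    rw [hD, ← Finset.union_sdiff_self_eq_union, Finset.card_union_of_disjoint Finset.disjoint_sdiff,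
      hb]
  rw [← Finset.card_univ_sdiff, ← Finset.card_powersetCard]
  -- an element of the intersection: multilinear, of support `γ ∪ supp β ⊇ D`, `|γ| = m`
  have key : ∀ δ ∈ aSet K mo g m β ∩ aSet K mo g' m β',
      IsML δ ∧ D ⊆ δ.support ∧ δ.support.card = m + b := by
    intro δ hδ
    rw [Finset.mem_inter, mem_aSet, mem_aSet] at hδ
    obtain ⟨⟨γ, hγ, -, -, rfl⟩, ⟨γ', hγ', -, -, hδ'⟩⟩ := hδ
    obtain ⟨hcard, hdisj⟩ := mem_sSet.1 hγ
    obtain ⟨-, hdisj'⟩ := mem_sSet.1 hγ'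
    refine ⟨isML_chi_add hdisj hβ, ?_, ?_⟩
    · rw [hD]
      refine Finset.union_subset ?_ ?_
      · rw [support_chi_add hdisj]; exact Finset.subset_union_right
      · rw [hδ', support_chi_add hdisj']; exact Finset.subset_union_right
    · rw [support_chi_add hdisj, Finset.card_union_of_disjoint hdisj, hcard, hb]
  refine Finset.card_le_card_of_injOn (fun δ => δ.support \ D) (fun δ hδ => ?_) ?_
  · obtain ⟨-, hDsub, hcard⟩ := key δ hδ
    rw [Finset.mem_coe, Finset.mem_powersetCard]
    refine ⟨Finset.sdiff_subset_sdiff (Finset.subset_univ _) subset_rfl, ?_⟩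
    rw [Finset.card_sdiff_of_subset hDsub, hcard, hcardD]
    omega
  · intro δ hδ δ' hδ' h
    obtain ⟨hML, hDsub, -⟩ := key δ hδ
    obtain ⟨hML', hDsub', -⟩ := key δ' hδ'
    have hs : δ.support = δ'.support := by
      rw [← Finset.sdiff_union_of_subset hDsub, ← Finset.sdiff_union_of_subset hDsub']
      exact congrArg (· ∪ D) h
    rw [← hML.chi_support, ← hML'.chi_support, hs]

end Inter

/-! ### The pair-count lower bound -/

section PairBound

variable {K : Type*} [Field K] {σ : Type*} [Fintype σ] [DecidableEq σ]

/-- **The pair-count lower bound for `Φ_{ℳ,m}`** (Kumar–Saraf 2017, §5.1 with §8.5, the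
deterministic core of Lemma 8.9). Let every derivative `∂_{Ls i} f` have only multilinear
monomials, all of support size `b`. If for all `i` and `β ∈ supp ∂_{Ls i} f`
`∑_{β' ∈ supp ∂_{Ls i} f} C(N-|β∪β'|, m) ≤ E·C(N-b, m)` and
`∑_{i'} ∑_{β' ∈ supp ∂_{Ls i'} f} C(N-|β∪β'|, m-|β'∖β|) ≤ Λ·C(N-b, m)` (`N = |σ|`, supports as
sets of variables), then `(∑_i |supp ∂_{Ls i} f|) · C(N-b, m) ≤ Φ_{ℳ,m}(f) · E² · Λ`.
The monomial order `mo` only serves to name leading monomials. [cite: KumarSaraf2017, §5.1] -/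
theorem sum_card_support_mul_choose_le {ι : Type*} [Fintype ι] [DecidableEq ι]
    (mo : MonomialOrder σ) (Ls : ι → List σ) (m b : ℕ) (f : MvPolynomial σ K)
    (hML : ∀ i, ∀ β ∈ (iterPderiv (Ls i) f).support, IsML β)
    (hb : ∀ i, ∀ β ∈ (iterPderiv (Ls i) f).support, β.support.card = b)
    {E Λ : ℝ} (hE0 : 0 ≤ E) (hΛ0 : 0 ≤ Λ)
    (hE : ∀ i, ∀ β ∈ (iterPderiv (Ls i) f).support, ∑ β' ∈ (iterPderiv (Ls i) f).support,
      ((Fintype.card σ - (β.support ∪ β'.support).card).choose m : ℝ) ≤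
        E * (Fintype.card σ - b).choose m)
    (hΛ : ∀ i, ∀ β ∈ (iterPderiv (Ls i) f).support, ∑ i', ∑ β' ∈ (iterPderiv (Ls i') f).support,
      ((Fintype.card σ - (β.support ∪ β'.support).card).choose
          (m - (β'.support \ β.support).card) : ℝ) ≤ Λ * (Fintype.card σ - b).choose m) :
    ((∑ i, (iterPderiv (Ls i) f).support.card : ℕ) : ℝ) * (Fintype.card σ - b).choose m ≤
      (pspDim Ls m f : ℝ) * E ^ 2 * Λ := by
  classical
  set C : ℝ := ((Fintype.card σ - b).choose m : ℝ) with hC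
  have hC0 : 0 ≤ C := Nat.cast_nonneg _
  set B : ι → Finset (σ →₀ ℕ) := fun i => (iterPderiv (Ls i) f).support with hBdef
  set A : (Σ _ : ι, σ →₀ ℕ) → Finset (σ →₀ ℕ) :=
    fun p => aSet K mo (iterPderiv (Ls p.1) f) m p.2 with hA
  set I : Finset (Σ _ : ι, σ →₀ ℕ) := (Finset.univ : Finset ι).sigma B with hI
  set U := I.biUnion A with hU
  -- Step 1 (Lemma 5.3 and `T₂`): `|B i| · C ≤ E · ∑_β |A(i, β)|`
  have step1 : ∀ i, ((B i).card : ℝ) * C ≤ E * ∑ β ∈ B i, ((A ⟨i, β⟩).card : ℝ) := by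
    intro i
    have hcs := sq_sum_card_le_card_biUnion_mul_sum_sum (B i) (sSet m)
    have hsum : ∑ β ∈ B i, (sSet m β).card = (B i).card * (Fintype.card σ - b).choose m := by
      rw [Finset.sum_const_nat fun β hβ => ?_]
      rw [card_sSet, hb i β hβ]
    have hpairs : (∑ β ∈ B i, ∑ β' ∈ B i, ((sSet m β ∩ sSet m β').card : ℝ)) ≤
        (B i).card * (E * C) := by
      calc (∑ β ∈ B i, ∑ β' ∈ B i, ((sSet m β ∩ sSet m β').card : ℝ))
          = ∑ β ∈ B i, ∑ β' ∈ B i,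
              ((Fintype.card σ - (β.support ∪ β'.support).card).choose m : ℝ) := by
            simp_rw [card_sSet_inter]
        _ ≤ ∑ β ∈ B i, E * C := Finset.sum_le_sum fun β hβ => hE i β hβ
        _ = (B i).card * (E * C) := by rw [Finset.sum_const, nsmul_eq_mul]
    have h' : (((B i).card * (Fintype.card σ - b).choose m : ℕ) : ℝ) ^ 2 ≤
        (((B i).biUnion (sSet m)).card : ℝ) *
          ∑ β ∈ B i, ∑ β' ∈ B i, ((sSet m β ∩ sSet m β').card : ℝ) := by
      rw [hsum] at hcs
      exact_mod_cast hcs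
    set X : ℝ := ((B i).card : ℝ) * C with hX
    set Y : ℝ := (((B i).biUnion (sSet m)).card : ℝ) with hY
    have hXX : X * X ≤ Y * E * X := by
      rw [Nat.cast_mul, sq] at h'
      calc X * X ≤ Y * ∑ β ∈ B i, ∑ β' ∈ B i, ((sSet m β ∩ sSet m β').card : ℝ) := h'
        _ ≤ Y * ((B i).card * (E * C)) := mul_le_mul_of_nonneg_left hpairs (Nat.cast_nonneg _)
        _ = Y * E * X := by rw [hX]; ring
    have hXle : X ≤ Y * E := by
      by_cases h0 : X = 0
      · rw [h0]; exact mul_nonneg (Nat.cast_nonneg _) hE0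
      · exact le_of_mul_le_mul_right hXX
          (lt_of_le_of_ne (mul_nonneg (Nat.cast_nonneg _) hC0) (Ne.symm h0))
    have h53nat := card_biUnion_sSet_le_sum_card_aSet (K := K) mo (iterPderiv (Ls i) f) (hML i) m
    have h53 : Y ≤ ∑ β ∈ B i, ((A ⟨i, β⟩).card : ℝ) := by
      rw [hY]
      exact_mod_cast h53nat
    calc X ≤ Y * E := hXle
      _ ≤ (∑ β ∈ B i, ((A ⟨i, β⟩).card : ℝ)) * E := mul_le_mul_of_nonneg_right h53 hE0
      _ = E * ∑ β ∈ B i, ((A ⟨i, β⟩).card : ℝ) := mul_comm _ _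
  -- Step 2: sum over `i`
  set TOT : ℝ := ((∑ i, (B i).card : ℕ) : ℝ) with hTOT
  set P : ℝ := ((∑ p ∈ I, (A p).card : ℕ) : ℝ) with hP
  have hP' : P = ∑ i, ∑ β ∈ B i, ((A ⟨i, β⟩).card : ℝ) := by
    rw [hP, Nat.cast_sum, hI, Finset.sum_sigma]
  have step2 : TOT * C ≤ E * P := by
    rw [hTOT, Nat.cast_sum, Finset.sum_mul, hP', Finset.mul_sum]
    exact Finset.sum_le_sum fun i _ => step1 i
  -- Step 3 (`T₃`): Cauchy–Schwarz over all pairs `(i, β)`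
  have hIcard : ((I.card : ℕ) : ℝ) = TOT := by
    rw [hTOT, hI, Finset.card_sigma]
  have step3 : P * P ≤ U.card * (TOT * (Λ * C)) := by
    have hcs := sq_sum_card_le_card_biUnion_mul_sum_sum I A
    have h' : P ^ 2 ≤ (U.card : ℝ) * ∑ p ∈ I, ∑ q ∈ I, ((A p ∩ A q).card : ℝ) := by
      rw [hP]; exact_mod_cast hcs
    rw [sq] at h'
    refine h'.trans (mul_le_mul_of_nonneg_left ?_ (Nat.cast_nonneg _))
    rw [← hIcard]
    calc (∑ p ∈ I, ∑ q ∈ I, ((A p ∩ A q).card : ℝ)) ≤ ∑ p ∈ I, Λ * C := by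
          refine Finset.sum_le_sum fun p hp => ?_
          rw [hI, Finset.mem_sigma] at hp
          rw [hI, Finset.sum_sigma]
          calc (∑ i', ∑ β' ∈ B i', ((A p ∩ A ⟨i', β'⟩).card : ℝ))
              ≤ ∑ i', ∑ β' ∈ B i', ((Fintype.card σ - (p.2.support ∪ β'.support).card).choose
                  (m - (β'.support \ p.2.support).card) : ℝ) := by
                refine Finset.sum_le_sum fun i' _ => Finset.sum_le_sum fun β' _ => ?_
                exact_mod_cast card_aSet_inter_le mo _ _ m β' (hML p.1 p.2 hp.2) (hb p.1 p.2 hp.2)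
            _ ≤ Λ * C := hΛ p.1 p.2 hp.2
      _ = (I.card : ℝ) * (Λ * C) := by rw [Finset.sum_const, nsmul_eq_mul]
  -- Step 4 (Lemma 5.1): `|U| ≤ Φ`, and combine
  have hUeq : U = (Finset.univ : Finset ι).biUnion
      (fun i => (B i).biUnion fun β => aSet K mo (iterPderiv (Ls i) f) m β) := by
    ext μ
    simp only [hU, hI, hA, Finset.mem_biUnion, Finset.mem_sigma, Finset.mem_univ, true_and]
    constructor
    · rintro ⟨p, hp, hμ⟩; exact ⟨p.1, p.2, hp, hμ⟩
    · rintro ⟨i, β, hβ, hμ⟩; exact ⟨⟨i, β⟩, hβ, hμ⟩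
  have step4nat := card_biUnion_aSet_le_pspDim (K := K) mo Ls m f Finset.univ B
  have step4 : (U.card : ℝ) ≤ pspDim Ls m f := by
    rw [hUeq]; exact_mod_cast step4nat
  have hTLC : 0 ≤ TOT * (Λ * C) := mul_nonneg (Nat.cast_nonneg _) (mul_nonneg hΛ0 hC0)
  by_cases h0 : TOT * C = 0
  · rw [h0]
    exact mul_nonneg (mul_nonneg (Nat.cast_nonneg _) (sq_nonneg _)) hΛ0
  · have hpos : 0 < TOT * C :=
      lt_of_le_of_ne (mul_nonneg (Nat.cast_nonneg _) hC0) (Ne.symm h0)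
    have h1 : (TOT * C) * (TOT * C) ≤ (E * P) * (E * P) :=
      mul_self_le_mul_self (mul_nonneg (Nat.cast_nonneg _) hC0) step2
    have h2 : (E * P) * (E * P) = E ^ 2 * (P * P) := by ring
    have h3 : (TOT * C) * (TOT * C) ≤ (pspDim Ls m f * E ^ 2 * Λ) * (TOT * C) := by
      calc (TOT * C) * (TOT * C) ≤ E ^ 2 * (P * P) := h2 ▸ h1
        _ ≤ E ^ 2 * (U.card * (TOT * (Λ * C))) := mul_le_mul_of_nonneg_left step3 (sq_nonneg _)
        _ ≤ E ^ 2 * (pspDim Ls m f * (TOT * (Λ * C))) :=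
            mul_le_mul_of_nonneg_left (mul_le_mul_of_nonneg_right step4 hTLC) (sq_nonneg _)
        _ = (pspDim Ls m f * E ^ 2 * Λ) * (TOT * C) := by ring
    exact le_of_mul_le_mul_right h3 hpos

end PairBound

end Literature.Computability.AlgebraicComplexity.KumarSaraf
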